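import Literature.Computability.AlgebraicComplexity.DGIJLLiftingFrame
import HarnessLib

/-!
# DGIJL Prop. 4.12 by explicit tableaux, I′: fillings from three bookkeeping functions

Topic `Literature/Computability/AlgebraicComplexity`; plumbing (no named facts), companion of
`DGIJLLiftingFrame.lean`. A `Spec` of that file asks for four bookkeeping functions of a filling
(`lab`, `idx`, `col`, `row`) and both round trips. This file shows that three suffice: the labelling
`lab` of the boxes, the box enumeration `col`/`row` of every label, ONE round trip
(`lab (col u s) (row u s) = u`) and injectivity of `s ↦ (col u s, row u s)` for each label — the
occurrence index `idx` is then recovered from the bijection `(label, index) ≃ boxes`, which exists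
because an injection between finite types of equal cardinality (`(10d+15) · d = ∑_c hgt c`) is a
bijection. This halves the case analysis of the five explicit fillings of the certificate for

* Dutta–Gesmundo–Ikenmeyer–Jindal–Lysikov, arXiv:2211.07055, **Prop. 4.12**,

see the design note `run/shared/lean/pub/val-lit/bip/DGIJL-Prop412-DESIGN-p6.md`. Honest framing:
infrastructure for a kernel certificate of a printed theorem; nothing here bears on VP versus VNP.
-/

noncomputable section

open scoped BigOperators

namespace Literature.Computability.AlgebraicComplexity

namespace DGIJLLift

open TableauEval

variable (k : ℕ)

/-- The number of boxes of the shape: `∑_c hgt c = (10d + 15) · d`, `d = 2k + 4`.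
[cite: DuttaGesmundoIkenmeyerJindalLysikovJSC2025, Prop. 4.12] -/
theorem card_boxes :
    Fintype.card ((c : Fin (30 * k + 59)) × Fin (hgt k c)) = (20 * k + 55) * (2 * k + 4) := by
  rw [Fintype.card_sigma]
  simp only [Fintype.card_fin]
  rw [Fin.sum_univ_eq_sum_range (fun c => hgt k c) (30 * k + 59),
    show 30 * k + 59 = (20 * k + 41) + (10 * k + 18) by ring, Finset.sum_range_add,
    Finset.sum_range_succ]
  have h1 : ∑ c ∈ Finset.range (20 * k + 40), hgt k c = (20 * k + 40) * (2 * k + 5) := by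
    rw [Finset.sum_congr rfl fun c hc => ?_, Finset.sum_const, Finset.card_range, smul_eq_mul]
    rw [Finset.mem_range] at hc
    unfold hgt; rw [if_pos hc]
  have h2 : hgt k (20 * k + 40) = 2 := by unfold hgt; rw [if_neg (lt_irrefl _), if_pos rfl]
  have h3 : ∑ t ∈ Finset.range (10 * k + 18), hgt k (20 * k + 41 + t) = 10 * k + 18 := by
    rw [Finset.sum_congr rfl fun t _ => ?_, Finset.sum_const, Finset.card_range, smul_eq_mul, mul_one]
    unfold hgt; rw [if_neg (by omega), if_neg (by omega)]
  rw [h1, h2, h3]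
  ring

/-- **A filling given by three bookkeeping functions**: the label `lab c r` of each box, the box
`(col u s, row u s)` of the `s`-th occurrence of each label, one round trip and injectivity in `s`.
[cite: IkenmeyerKandasamy2019, §13 (Thm. 4.2)] -/
structure SlimSpec (k : ℕ) where
  /-- label of the box `(c, r)` -/
  lab : ℕ → ℕ → ℕ
  /-- column of the `s`-th box of label `u` -/
  col : ℕ → ℕ → ℕ
  /-- row of the `s`-th box of label `u` -/
  row : ℕ → ℕ → ℕ
  /-- range of `col` -/
  col_lt : ∀ {u s : ℕ}, u < 20 * k + 55 → s < 2 * k + 4 → col u s < 30 * k + 59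
  /-- range of `row` -/
  row_lt : ∀ {u s : ℕ}, u < 20 * k + 55 → s < 2 * k + 4 → row u s < hgt k (col u s)
  /-- range of `lab` -/
  lab_lt : ∀ {c r : ℕ}, c < 30 * k + 59 → r < hgt k c → lab c r < 20 * k + 55
  /-- round trip at labels -/
  lab_col_row : ∀ {u s : ℕ}, u < 20 * k + 55 → s < 2 * k + 4 → lab (col u s) (row u s) = u
  /-- the boxes of one label are distinct -/
  col_row_inj : ∀ {u s s' : ℕ}, u < 20 * k + 55 → s < 2 * k + 4 → s' < 2 * k + 4 →
    col u s = col u s' → row u s = row u s' → s = s'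

namespace SlimSpec

variable {k} (S : SlimSpec k)

/-- The box map `(label, index) ↦ box`. [cite: IkenmeyerKandasamy2019, §13 (Thm. 4.2)] -/
def boxFun (p : Fin (20 * k + 55) × Fin (2 * k + 4)) : (c : Fin (30 * k + 59)) × Fin (hgt k c) :=
  ⟨⟨S.col p.1 p.2, S.col_lt p.1.2 p.2.2⟩, ⟨S.row p.1 p.2, S.row_lt p.1.2 p.2.2⟩⟩

/-- The box map is injective (labels from the round trip, indices from `col_row_inj`).
[cite: IkenmeyerKandasamy2019, §13 (Thm. 4.2)] -/
theorem boxFun_injective : Function.Injective S.boxFun := by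
  rintro ⟨u, s⟩ ⟨u', s'⟩ h
  have hc : S.col u s = S.col u' s' := by
    have := congrArg (fun b : (c : Fin (30 * k + 59)) × Fin (hgt k c) => (b.1 : ℕ)) h
    exact this
  have hr : S.row u s = S.row u' s' := by
    have h2 := congrArg (fun b : (c : Fin (30 * k + 59)) × Fin (hgt k c) => (b.2 : ℕ)) h
    exact h2
  have hu : (u : ℕ) = u' := by
    rw [← S.lab_col_row u.2 s.2, ← S.lab_col_row u'.2 s'.2, hc, hr]
  obtain rfl : u = u' := Fin.ext hu
  have hs : (s : ℕ) = s' := S.col_row_inj u.2 s.2 s'.2 hc hr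
  obtain rfl : s = s' := Fin.ext hs
  rfl

/-- The box map is bijective (injective between finite types of equal cardinality).
[cite: IkenmeyerKandasamy2019, §13 (Thm. 4.2)] -/
theorem boxFun_bijective : Function.Bijective S.boxFun := by
  rw [Fintype.bijective_iff_injective_and_card]
  refine ⟨S.boxFun_injective, ?_⟩
  rw [Fintype.card_prod, Fintype.card_fin, Fintype.card_fin, card_boxes]

/-- The bijection `(label, index) ≃ boxes`. [cite: IkenmeyerKandasamy2019, §13 (Thm. 4.2)] -/
def boxEquiv : Fin (20 * k + 55) × Fin (2 * k + 4) ≃ (c : Fin (30 * k + 59)) × Fin (hgt k c) :=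
  Equiv.ofBijective S.boxFun S.boxFun_bijective

/-- The recovered occurrence index of the box `(c, r)` (junk `0` out of range).
[cite: IkenmeyerKandasamy2019, §13 (Thm. 4.2)] -/
def idx (c r : ℕ) : ℕ :=
  if h : c < 30 * k + 59 ∧ r < hgt k c then ((S.boxEquiv.symm ⟨⟨c, h.1⟩, ⟨r, h.2⟩⟩).2 : ℕ) else 0

/-- The label read back through the bijection is `lab`. [cite: IkenmeyerKandasamy2019, §13 (Thm. 4.2)] -/
theorem boxEquiv_symm_fst (b : (c : Fin (30 * k + 59)) × Fin (hgt k c)) :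
    ((S.boxEquiv.symm b).1 : ℕ) = S.lab b.1 b.2 := by
  set p := S.boxEquiv.symm b with hp
  have hb : S.boxFun p = b := by
    rw [hp]; exact S.boxEquiv.apply_symm_apply b
  rw [← hb]
  exact (S.lab_col_row p.1.2 p.2.2).symm

/-- **The full `Spec` of a slim filling** (the fourth function and the second round trip recovered
from the bijection). [cite: IkenmeyerKandasamy2019, §13 (Thm. 4.2)] -/
def toSpec : Spec k where
  lab := S.lab
  idx := S.idx
  col := S.col
  row := S.row
  col_lt := S.col_lt
  row_lt := S.row_lt
  lab_lt := S.lab_lt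
  idx_lt := by
    intro c r hc hr
    unfold idx
    rw [dif_pos ⟨hc, hr⟩]
    exact ((S.boxEquiv.symm _).2).2
  lab_col_row := S.lab_col_row
  idx_col_row := by
    intro u s hu hs
    unfold idx
    rw [dif_pos ⟨S.col_lt hu hs, S.row_lt hu hs⟩]
    have : S.boxEquiv.symm ⟨⟨S.col u s, S.col_lt hu hs⟩, ⟨S.row u s, S.row_lt hu hs⟩⟩ =
        (⟨u, hu⟩, ⟨s, hs⟩) := by
      rw [Equiv.symm_apply_eq]
      rfl
    rw [this]
  col_lab_idx := by
    intro c r hc hr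
    unfold idx
    rw [dif_pos ⟨hc, hr⟩]
    set b : (c : Fin (30 * k + 59)) × Fin (hgt k c) := ⟨⟨c, hc⟩, ⟨r, hr⟩⟩ with hb
    have h1 : S.lab c r = ((S.boxEquiv.symm b).1 : ℕ) := (S.boxEquiv_symm_fst b).symm
    rw [h1]
    have h2 : S.boxFun (S.boxEquiv.symm b) = b := S.boxEquiv.apply_symm_apply b
    exact congrArg (fun x : (c : Fin (30 * k + 59)) × Fin (hgt k c) => (x.1 : ℕ)) h2
  row_lab_idx := by
    intro c r hc hr
    unfold idx
    rw [dif_pos ⟨hc, hr⟩]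
    set b : (c : Fin (30 * k + 59)) × Fin (hgt k c) := ⟨⟨c, hc⟩, ⟨r, hr⟩⟩ with hb
    have h1 : S.lab c r = ((S.boxEquiv.symm b).1 : ℕ) := (S.boxEquiv_symm_fst b).symm
    rw [h1]
    have h2 : S.boxFun (S.boxEquiv.symm b) = b := S.boxEquiv.apply_symm_apply b
    exact congrArg (fun x : (c : Fin (30 * k + 59)) × Fin (hgt k c) => (x.2 : ℕ)) h2

/-- The full `Spec` keeps the labelling. [cite: IkenmeyerKandasamy2019, §13 (Thm. 4.2)] -/
@[simp] theorem toSpec_lab : S.toSpec.lab = S.lab := rfl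

end SlimSpec

end DGIJLLift

end Literature.Computability.AlgebraicComplexity

end
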